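import Mathlib.Analysis.SpecialFunctions.Gaussian.FourierTransform
import Mathlib.Analysis.InnerProductSpace.NormDet
import Mathlib.MeasureTheory.Measure.Lebesgue.EqHaar
import HarnessLib

/-!
# The Gaussian integral of a quadratic form given by a linear map: `∫ exp(−b‖T v‖²) dv = (π/b)^{d/2} / normDet T`
# (lane A of S-BASE, crux `TwistedTraceScaling` stmt-QuantumFields-20203, C4 INNER; design note `pub/ym-fleet/ym-luscher-20007-p1/COARSE-DESIGN.md` §23.8 (N2))

The Laplace evaluation (N2) of the Faddeev–Popov weight in based gauge coordinates (`…GaugeAverageBased`, `…GaugeActionBased`, `…SliceFormBased`) and the stiff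
Gaussian of the Born–Oppenheimer model both reduce to ONE finite-dimensional identity, proved here once:
* ★★ `integral_exp_neg_mul_sq_norm_comp` — for an endomorphism `T` of a finite-dimensional real inner product space `V` with `det T ≠ 0` and `b > 0`:
  `∫ v, exp(−b‖T v‖²) = (π/b)^{dim V/2} / |det T|` (Mathlib's `integral_rexp_neg_mul_sq_norm` + the linear change of variables `map_linearMap_addHaar_eq_smul_addHaar`);
* ★★ `integral_exp_neg_mul_sq_norm_comp_of_injective` — for an INJECTIVE linear map `A : V → W` into another inner product space of the SAME dimension:
  `∫ v, exp(−b‖A v‖²) = (π/b)^{dim V/2} / A.normDet`, `normDet A = √det(AᵀA)` Mathlib's Gram determinant (`LinearMap.normDet`; via an isometry `W ≃ₗᵢ V` built from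
  orthonormal bases and `normDet_comp_of_finrank_eq`, `LinearIsometry.normDet_eq_one`, `normDet_eq_abs_det`).
HONEST FRAMING: textbook calculus for a stub of a child of the CONDITIONAL reduction route R2b1; no spectral claim; C4 OPEN; not a gap, not Clay.
-/

set_option autoImplicit false

noncomputable section

open MeasureTheory Real Module

namespace Summit.QuantumFields.YangMills.Theorems.FemtoTransferGap.TwoLattice.ConstTube

variable {V W : Type*} [NormedAddCommGroup V] [InnerProductSpace ℝ V] [FiniteDimensional ℝ V] [MeasurableSpace V] [BorelSpace V]
  [NormedAddCommGroup W] [InnerProductSpace ℝ W] [FiniteDimensional ℝ W]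

/-- ★★ **Gaussian integral of `‖T v‖²` for an invertible endomorphism**: `∫ exp(−b‖T v‖²) dv = (π/b)^{dim V/2} / |det T|`. [folklore] -/
theorem integral_exp_neg_mul_sq_norm_comp (T : V →ₗ[ℝ] V) (hT : LinearMap.det T ≠ 0) {b : ℝ} (hb : 0 < b) :
    ∫ v, Real.exp (-b * ‖T v‖ ^ 2) = (π / b) ^ (finrank ℝ V / 2 : ℝ) / |LinearMap.det T| := by
  have hg : AEStronglyMeasurable (fun v : V => Real.exp (-b * ‖v‖ ^ 2)) (Measure.map T volume) :=
    (by fun_prop : Continuous fun v : V => Real.exp (-b * ‖v‖ ^ 2)).aestronglyMeasurable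
  have hTm : AEMeasurable T volume := T.continuous_of_finiteDimensional.measurable.aemeasurable
  calc ∫ v, Real.exp (-b * ‖T v‖ ^ 2) = ∫ v, Real.exp (-b * ‖v‖ ^ 2) ∂(Measure.map T volume) := (integral_map hTm hg).symm
    _ = ∫ v, Real.exp (-b * ‖v‖ ^ 2) ∂(ENNReal.ofReal |(LinearMap.det T)⁻¹| • (volume : Measure V)) := by
        rw [Measure.map_linearMap_addHaar_eq_smul_addHaar _ hT]
    _ = |(LinearMap.det T)⁻¹| * ∫ v : V, Real.exp (-b * ‖v‖ ^ 2) := by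
        rw [integral_smul_measure, ENNReal.toReal_ofReal (abs_nonneg _), smul_eq_mul]
    _ = (π / b) ^ (finrank ℝ V / 2 : ℝ) / |LinearMap.det T| := by
        rw [GaussianFourier.integral_rexp_neg_mul_sq_norm hb, abs_inv, inv_mul_eq_div]

/-- An isometry between real inner product spaces of equal finite dimension (from orthonormal bases). [folklore] -/
def isometryOfFinrankEq (h : finrank ℝ W = finrank ℝ V) : W ≃ₗᵢ[ℝ] V :=
  ((stdOrthonormalBasis ℝ W).repr.trans (LinearIsometryEquiv.piLpCongrLeft 2 ℝ ℝ (finCongr h))).trans (stdOrthonormalBasis ℝ V).repr.symm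

/-- ★★ **Gaussian integral of `‖A v‖²` for an injective linear map into a space of the same dimension**: `∫ exp(−b‖A v‖²) dv = (π/b)^{dim V/2} / normDet A`. [folklore] -/
theorem integral_exp_neg_mul_sq_norm_comp_of_injective (A : V →ₗ[ℝ] W) (hA : Function.Injective A) (h : finrank ℝ W = finrank ℝ V) {b : ℝ}
    (hb : 0 < b) : ∫ v, Real.exp (-b * ‖A v‖ ^ 2) = (π / b) ^ (finrank ℝ V / 2 : ℝ) / A.normDet := by
  set J := isometryOfFinrankEq (V := V) (W := W) h with hJ
  set T : V →ₗ[ℝ] V := (J.toLinearIsometry.toLinearMap) ∘ₗ A with hT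
  have hnorm : ∀ v, ‖T v‖ = ‖A v‖ := fun v => by
    rw [hT, LinearMap.comp_apply]
    exact J.norm_map (A v)
  have hnd : T.normDet = A.normDet := by
    rw [hT, LinearMap.normDet_comp_of_finrank_eq A J.toLinearIsometry.toLinearMap h.symm, LinearIsometry.normDet_eq_one, one_mul]
  have hA0 : A.normDet ≠ 0 := by
    intro h0
    have := (LinearMap.normDet_eq_zero_iff_ker_ne_bot.mp h0)
    exact this (LinearMap.ker_eq_bot.mpr hA)
  have hdet : |LinearMap.det T| = A.normDet := by rw [← LinearMap.normDet_eq_abs_det, hnd]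
  have hT0 : LinearMap.det T ≠ 0 := by
    intro h0; apply hA0; rw [← hdet, h0, abs_zero]
  simp_rw [← hnorm]
  rw [integral_exp_neg_mul_sq_norm_comp T hT0 hb, hdet]

end Summit.QuantumFields.YangMills.Theorems.FemtoTransferGap.TwoLattice.ConstTube

end
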